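import Mathlib
import Literature.Probability.Percolation.PercolationSharpThreshold
import Summits.CriticalPhenomena.CardyFormulaZ2.Theorems.CardySelfRefinementGradientComparabilityStubBulkPivotalSumDivergesSections
import HarnessLib

/-!
# Talagrand–Rossignol for the SECTIONS of the joint crossing event given a layer: one cut

Crux `stmt-CriticalPhenomena-10269`
(`Summit.CriticalPhenomena.CardyFormulaZ2.Theses.CardySelfRefinement.GradientComparability`),
line **Sketch**, helper file of the stub `stub_bulkPivotalSum_diverges` (D3-bulk).  Vocabulary
(`Aloc`, `window`) from `CardySelfRefinementDefs`; sections `A^ξ = {ω | (ω ∖ L) ∪ ξ ∈ Aloc}` and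
their disintegration from `…StubBulkPivotalSumDivergesSections`.

## Mathematics

`W` the window, `L ⊆ W` the layer, `B = W ∖ L` the bulk, `ξ ⊆ L` a layer configuration,
`t = P(A^ξ)`, `I_e(ξ) = P(e pivotal for A^ξ)`, `S₁ = Σ_{e∈B} I_e(ξ)`, `S₂ = Σ_{e∈B} I_e(ξ)²`.
The tree's Talagrand–Rossignol inequality `SharpThreshold.sharpThreshold_event` applied to the
increasing `B`-determined event `A^ξ` at `p = ½` reads `t(1−t) log(4t(1−t)/S₂) ≤ 2S₁`
(`S₂ > 0` as soon as `0 < t < 1`, `sum_sq_real_isPivotal_pos`).  Hence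
(`one_le_of_section_nondegenerate`): if `t(1−t) ≥ v > 0` then either `S₁ ≥ N'` or
`S₂ ≥ ψ := 4v·e^{−2N'/v}`; if moreover `I_e(ξ) ≤ π` for the bulk edges off a set `near ⊆ B`, then
`S₂ ≤ π S₁ + S₁^{near}`, so that in all cases `1 ≤ S₁/N' + S₁^{near}/(ψ − πN')` (when `πN' < ψ`).
Integrating against `P(ω ∩ L = ξ)` with the disintegration
`P(e pivotal for Aloc) = Σ_ξ P(ω ∩ L = ξ) I_e(ξ)` (`percut_mass`, and `percut_mean`, the registered
sub-goal):

  `2v₀ ≤ (1/N') Σ_{e∈B} P(e pivotal) + (1/(ψ − πN')) Σ_{e∈near} P(e pivotal)`,  `ψ = 2v₀e^{−4N'/v₀}`,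

whenever the conditional variance `Σ_ξ P(ω ∩ L = ξ) t_ξ(1 − t_ξ)` is at least `v₀`.  This is the
"one cut" inequality of the bulk divergence argument (Talagrand 1994, Thm 1.1; Rossignol 2006,
Thm 2.1, for the sections); the smallness of `π` (one open arm inside the bulk) and the lower bound
`v₀` (non-degeneracy of the crossing event given the boundary layer) are supplied elsewhere.
-/

noncomputable section

namespace Summit.CriticalPhenomena.CardyFormulaZ2.Theorems.CardySelfRefinement

open scoped Topology
open Filter Set MeasureTheory
open Literature.Probability.LatticeModels Literature.Probability.Percolation
open Literature.Probability.Percolation.QuadCrossing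
open Summit.CriticalPhenomena.CardyFormulaZ2.Theses.CardySelfRefinement

/-! ## One cut: Talagrand for the sections, integrated over the layer -/

/-- **Pointwise step.**  For a layer configuration `ξ ⊆ L` with `t(1−t) ≥ v > 0` (`t = P(A^ξ)`):
if the bulk edges off `near` have section influence `≤ π` and `πN' < ψ := 4v e^{−2N'/v}`, then
`1 ≤ S₁/N' + S₁^{near}/(ψ − πN')` (Talagrand–Rossignol for `A^ξ` on the bulk cube: either
`S₁ ≥ N'`, or `S₂ ≥ ψ` and `S₂ ≤ πS₁ + S₁^{near}`). -/
theorem one_le_of_section_nondegenerate (m : ℕ) (F : Fin m → Quad (Set.univ : Set ℂ)) {η : ℝ}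
    {W L near ξ : Finset (Sym2 (Site 2))} (hW : (↑W : Set (Sym2 (Site 2))) = window m F η)
    (hnear : near ⊆ W \ L) {π v N' : ℝ} (hπ : 0 ≤ π) (hv : 0 < v) (hN' : 0 < N')
    (hπN : π * N' < 4 * v * Real.exp (-(2 * N' / v)))
    (hsmall : ∀ e ∈ (W \ L) \ near, (bondPercolation (zdGraph 2) half).real
      {ω | IsPivotal {ω' : BondConfig (Site 2) | ω' \ ↑L ∪ ↑ξ ∈ Aloc m F η} e ω} ≤ π)
    (hnd : v ≤ (bondPercolation (zdGraph 2) half).real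
        {ω' : BondConfig (Site 2) | ω' \ ↑L ∪ ↑ξ ∈ Aloc m F η} *
      (1 - (bondPercolation (zdGraph 2) half).real
        {ω' : BondConfig (Site 2) | ω' \ ↑L ∪ ↑ξ ∈ Aloc m F η})) :
    1 ≤ 1 / N' * ∑ e ∈ W \ L, (bondPercolation (zdGraph 2) half).real
        {ω | IsPivotal {ω' : BondConfig (Site 2) | ω' \ ↑L ∪ ↑ξ ∈ Aloc m F η} e ω} +
      1 / (4 * v * Real.exp (-(2 * N' / v)) - π * N') * ∑ e ∈ near,
        (bondPercolation (zdGraph 2) half).real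
          {ω | IsPivotal {ω' : BondConfig (Site 2) | ω' \ ↑L ∪ ↑ξ ∈ Aloc m F η} e ω} := by
  set μ := bondPercolation (zdGraph 2) half with hμ
  set E : Set (BondConfig (Site 2)) := {ω' | ω' \ ↑L ∪ ↑ξ ∈ Aloc m F η} with hE
  set ψ : ℝ := 4 * v * Real.exp (-(2 * N' / v)) with hψ
  set S₁ : ℝ := ∑ e ∈ W \ L, μ.real {ω | IsPivotal E e ω} with hS₁
  set Sn : ℝ := ∑ e ∈ near, μ.real {ω | IsPivotal E e ω} with hSn
  have hI_nn : ∀ e, 0 ≤ μ.real {ω | IsPivotal E e ω} := fun e => measureReal_nonneg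
  have hI_le : ∀ e, μ.real {ω | IsPivotal E e ω} ≤ 1 := fun e => measureReal_le_one
  have hS₁nn : 0 ≤ S₁ := Finset.sum_nonneg fun e _ => hI_nn e
  have hSn_nn : 0 ≤ Sn := Finset.sum_nonneg fun e _ => hI_nn e
  have hψπ : 0 < ψ - π * N' := by linarith
  by_cases hcase : N' ≤ S₁
  · have h1 : 1 ≤ 1 / N' * S₁ := by
      rw [div_mul_eq_mul_div, one_mul, le_div_iff₀ hN']; linarith
    have h2 : 0 ≤ 1 / (ψ - π * N') * Sn := by positivity
    linarith
  rw [not_le] at hcase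
  -- Talagrand–Rossignol for the section on the bulk cube
  have hB : (↑(W \ L) : Set (Sym2 (Site 2))) ⊆ (zdGraph 2).edgeSet := by
    intro e he
    rw [Finset.coe_sdiff] at he
    exact mem_edgeSet_of_mem_window (m := m) (F := F) (η := η) (hW ▸ he.1)
  set t : ℝ := μ.real E with ht
  have httpos : 0 < t * (1 - t) := lt_of_lt_of_le hv hnd
  have hS₂pos : 0 < ∑ e ∈ W \ L, μ.real {ω | IsPivotal E e ω} ^ 2 :=
    sum_sq_real_isPivotal_pos (isUpperSet_section m F η ↑L ↑ξ) hB
      (determinedBy_section m F η L ξ hW) httpos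
  set S₂ : ℝ := ∑ e ∈ W \ L, μ.real {ω | IsPivotal E e ω} ^ 2 with hS₂
  have hhalf : ((half : unitInterval) : ℝ) = 1 / 2 := rfl
  have hTal := SharpThreshold.sharpThreshold_event (G := zdGraph 2) (F := W \ L) hB
    (isUpperSet_section m F η ↑L ↑ξ) (determinedBy_section m F η L ξ hW) half
    (by rw [hhalf]; norm_num) (by rw [hhalf]; norm_num) httpos hS₂pos
  rw [hhalf] at hTal
  have h4 : (4 : ℝ) * (1 / 2) ^ 2 * (1 - 1 / 2) ^ 2 = 1 / 4 := by norm_num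
  rw [h4] at hTal
  change t * (1 - t) * Real.log (t * (1 - t) / (1 / 4 * S₂)) ≤ 2 * S₁ at hTal
  -- `ψ ≤ S₂`
  have hS₂ψ : ψ ≤ S₂ := by
    by_contra hlt
    rw [not_le] at hlt
    have hq : Real.exp (2 * N' / v) < t * (1 - t) / (1 / 4 * S₂) := by
      rw [lt_div_iff₀ (by positivity)]
      calc Real.exp (2 * N' / v) * (1 / 4 * S₂)
          < Real.exp (2 * N' / v) * (1 / 4 * ψ) := by gcongr
        _ = v := by
            rw [hψ, Real.exp_neg]
            field_simp
        _ ≤ t * (1 - t) := hnd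
    have hlog : 2 * N' / v < Real.log (t * (1 - t) / (1 / 4 * S₂)) := by
      calc 2 * N' / v = Real.log (Real.exp (2 * N' / v)) := (Real.log_exp _).symm
        _ < _ := Real.log_lt_log (Real.exp_pos _) hq
    have hlogpos : 0 < Real.log (t * (1 - t) / (1 / 4 * S₂)) := lt_trans (by positivity) hlog
    have hmain : 2 * N' < t * (1 - t) * Real.log (t * (1 - t) / (1 / 4 * S₂)) := by
      calc 2 * N' = v * (2 * N' / v) := by field_simp
        _ < v * Real.log (t * (1 - t) / (1 / 4 * S₂)) := by gcongr
        _ ≤ t * (1 - t) * Real.log (t * (1 - t) / (1 / 4 * S₂)) := by gcongr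
    linarith
  -- `S₂ ≤ π S₁ + Sn`
  have hsplit : S₂ ≤ π * S₁ + Sn := by
    rw [hS₂, ← Finset.sum_sdiff hnear]
    have hA : ∑ e ∈ (W \ L) \ near, μ.real {ω | IsPivotal E e ω} ^ 2 ≤ π * S₁ := by
      calc ∑ e ∈ (W \ L) \ near, μ.real {ω | IsPivotal E e ω} ^ 2
          ≤ ∑ e ∈ (W \ L) \ near, π * μ.real {ω | IsPivotal E e ω} :=
            Finset.sum_le_sum fun e he => by
              have h1 := hsmall e he
              have h0 := hI_nn e
              nlinarith
        _ = π * ∑ e ∈ (W \ L) \ near, μ.real {ω | IsPivotal E e ω} := by rw [Finset.mul_sum]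
        _ ≤ π * S₁ := by
            gcongr
            exact Finset.sum_le_sum_of_subset_of_nonneg Finset.sdiff_subset fun e _ _ => hI_nn e
    have hB' : ∑ e ∈ near, μ.real {ω | IsPivotal E e ω} ^ 2 ≤ Sn :=
      Finset.sum_le_sum fun e _ => by
        have h0 := hI_nn e
        have h1 := hI_le e
        nlinarith
    linarith
  have hπS : π * S₁ ≤ π * N' := mul_le_mul_of_nonneg_left hcase.le hπ
  have hSnψ : ψ - π * N' ≤ Sn := by linarith
  have h2 : 1 ≤ 1 / (ψ - π * N') * Sn := by
    rw [div_mul_eq_mul_div, one_mul, le_div_iff₀ hψπ]; linarith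
  have h1 : 0 ≤ 1 / N' * S₁ := by positivity
  linarith

/-- **One cut, mass form.**  With `W` the window, `L ⊆ W` the layer, `near ⊆ W ∖ L`, section
influences `≤ π` off `near` for every layer configuration, and `πN' < ψ = 4v e^{−2N'/v}`:
`P(t_ξ(1 − t_ξ) ≥ v) ≤ (1/N') Σ_{e ∈ W∖L} P(e pivotal for Aloc) + (1/(ψ−πN')) Σ_{e∈near} P(e
pivotal for Aloc)`, the probability on the left being that of the set of layer configurations
`ξ` whose section is non-degenerate. -/
theorem percut_mass (m : ℕ) (F : Fin m → Quad (Set.univ : Set ℂ)) {η : ℝ} (hη : η ≠ 0)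
    {W L near : Finset (Sym2 (Site 2))} (hW : (↑W : Set (Sym2 (Site 2))) = window m F η)
    (hnear : near ⊆ W \ L) {π v N' : ℝ} (hπ : 0 ≤ π) (hv : 0 < v) (hN' : 0 < N')
    (hπN : π * N' < 4 * v * Real.exp (-(2 * N' / v)))
    (hsmall : ∀ ξ ∈ L.powerset, ∀ e ∈ (W \ L) \ near, (bondPercolation (zdGraph 2) half).real
      {ω | IsPivotal {ω' : BondConfig (Site 2) | ω' \ ↑L ∪ ↑ξ ∈ Aloc m F η} e ω} ≤ π) :
    ∑ ξ ∈ L.powerset.filter (fun ξ : Finset (Sym2 (Site 2)) =>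
        v ≤ (bondPercolation (zdGraph 2) half).real
          {ω' : BondConfig (Site 2) | ω' \ ↑L ∪ ↑ξ ∈ Aloc m F η} *
        (1 - (bondPercolation (zdGraph 2) half).real
          {ω' : BondConfig (Site 2) | ω' \ ↑L ∪ ↑ξ ∈ Aloc m F η})),
        (bondPercolation (zdGraph 2) half).real {ω | obs ω L = ξ} ≤
      1 / N' * ∑ e ∈ W \ L, (bondPercolation (zdGraph 2) half).real
          {ω | IsPivotal (Aloc m F η) e ω} +
        1 / (4 * v * Real.exp (-(2 * N' / v)) - π * N') * ∑ e ∈ near,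
          (bondPercolation (zdGraph 2) half).real {ω | IsPivotal (Aloc m F η) e ω} := by
  set μ := bondPercolation (zdGraph 2) half with hμ
  set c : ℝ := 1 / (4 * v * Real.exp (-(2 * N' / v)) - π * N') with hc
  have hc0 : 0 ≤ c := by rw [hc]; exact div_nonneg zero_le_one (by linarith)
  have hrw : ∀ e ∈ W \ L, μ.real {ω | IsPivotal (Aloc m F η) e ω} =
      ∑ ξ ∈ L.powerset, μ.real {ω | obs ω L = ξ} * μ.real
        {ω | IsPivotal {ω' : BondConfig (Site 2) | ω' \ ↑L ∪ ↑ξ ∈ Aloc m F η} e ω} :=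
    fun e he => real_isPivotal_eq_sum_powerset m F hη L (Finset.mem_sdiff.1 he).2
  have h1 : ∑ e ∈ W \ L, μ.real {ω | IsPivotal (Aloc m F η) e ω} =
      ∑ ξ ∈ L.powerset, μ.real {ω | obs ω L = ξ} * ∑ e ∈ W \ L, μ.real
        {ω | IsPivotal {ω' : BondConfig (Site 2) | ω' \ ↑L ∪ ↑ξ ∈ Aloc m F η} e ω} := by
    rw [Finset.sum_congr rfl hrw, Finset.sum_comm]
    exact Finset.sum_congr rfl fun ξ _ => (Finset.mul_sum _ _ _).symm
  have h2 : ∑ e ∈ near, μ.real {ω | IsPivotal (Aloc m F η) e ω} =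
      ∑ ξ ∈ L.powerset, μ.real {ω | obs ω L = ξ} * ∑ e ∈ near, μ.real
        {ω | IsPivotal {ω' : BondConfig (Site 2) | ω' \ ↑L ∪ ↑ξ ∈ Aloc m F η} e ω} := by
    rw [Finset.sum_congr rfl fun e he => hrw e (hnear he), Finset.sum_comm]
    exact Finset.sum_congr rfl fun ξ _ => (Finset.mul_sum _ _ _).symm
  rw [Finset.sum_filter, h1, h2, Finset.mul_sum, Finset.mul_sum, ← Finset.sum_add_distrib]
  refine Finset.sum_le_sum fun ξ hξ => ?_
  have hw : 0 ≤ μ.real {ω | obs ω L = ξ} := measureReal_nonneg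
  have hS : 0 ≤ ∑ e ∈ W \ L, μ.real
      {ω | IsPivotal {ω' : BondConfig (Site 2) | ω' \ ↑L ∪ ↑ξ ∈ Aloc m F η} e ω} :=
    Finset.sum_nonneg fun _ _ => measureReal_nonneg
  have hS' : 0 ≤ ∑ e ∈ near, μ.real
      {ω | IsPivotal {ω' : BondConfig (Site 2) | ω' \ ↑L ∪ ↑ξ ∈ Aloc m F η} e ω} :=
    Finset.sum_nonneg fun _ _ => measureReal_nonneg
  split_ifs with hgood
  · have hone := one_le_of_section_nondegenerate m F hW hnear hπ hv hN' hπN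
      (hsmall ξ hξ) hgood
    have hN0 : 0 ≤ 1 / N' := by positivity
    calc μ.real {ω | obs ω L = ξ} = μ.real {ω | obs ω L = ξ} * 1 := (mul_one _).symm
      _ ≤ μ.real {ω | obs ω L = ξ} * (1 / N' * ∑ e ∈ W \ L, μ.real
            {ω | IsPivotal {ω' : BondConfig (Site 2) | ω' \ ↑L ∪ ↑ξ ∈ Aloc m F η} e ω} +
          c * ∑ e ∈ near, μ.real
            {ω | IsPivotal {ω' : BondConfig (Site 2) | ω' \ ↑L ∪ ↑ξ ∈ Aloc m F η} e ω}) :=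
          mul_le_mul_of_nonneg_left hone hw
      _ = _ := by ring
  · have : 0 ≤ μ.real {ω | obs ω L = ξ} * (1 / N' * ∑ e ∈ W \ L, μ.real
            {ω | IsPivotal {ω' : BondConfig (Site 2) | ω' \ ↑L ∪ ↑ξ ∈ Aloc m F η} e ω} +
          c * ∑ e ∈ near, μ.real
            {ω | IsPivotal {ω' : BondConfig (Site 2) | ω' \ ↑L ∪ ↑ξ ∈ Aloc m F η} e ω}) := by
      positivity
    linarith

/-- **One cut, mean form** (the interface used by the bulk divergence argument).  If the
conditional variance of `Aloc` given the layer is at least `v₀`,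
`v₀ ≤ Σ_{ξ ⊆ L} P(ω ∩ L = ξ) · t_ξ(1 − t_ξ)`, the section influences off `near` are `≤ π`, and
`πN' < ψ = 2v₀ e^{−4N'/v₀}`, then
`2v₀ ≤ (1/N') Σ_{e ∈ W∖L} P(e pivotal) + (1/(ψ − πN')) Σ_{e ∈ near} P(e pivotal)`. -/
theorem percut_mean (m : ℕ) (F : Fin m → Quad (Set.univ : Set ℂ)) {η : ℝ} (hη : η ≠ 0)
    {W L near : Finset (Sym2 (Site 2))} (hW : (↑W : Set (Sym2 (Site 2))) = window m F η)
    (hnear : near ⊆ W \ L) {π v₀ N' : ℝ} (hπ : 0 ≤ π) (hv₀ : 0 < v₀) (hN' : 0 < N')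
    (hπN : π * N' < 4 * (v₀ / 2) * Real.exp (-(2 * N' / (v₀ / 2))))
    (hsmall : ∀ ξ ∈ L.powerset, ∀ e ∈ (W \ L) \ near, (bondPercolation (zdGraph 2) half).real
      {ω | IsPivotal {ω' : BondConfig (Site 2) | ω' \ ↑L ∪ ↑ξ ∈ Aloc m F η} e ω} ≤ π)
    (hmean : v₀ ≤ ∑ ξ ∈ L.powerset, (bondPercolation (zdGraph 2) half).real {ω | obs ω L = ξ} *
      ((bondPercolation (zdGraph 2) half).real
          {ω' : BondConfig (Site 2) | ω' \ ↑L ∪ ↑ξ ∈ Aloc m F η} *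
        (1 - (bondPercolation (zdGraph 2) half).real
          {ω' : BondConfig (Site 2) | ω' \ ↑L ∪ ↑ξ ∈ Aloc m F η}))) :
    2 * v₀ ≤ 1 / N' * ∑ e ∈ W \ L, (bondPercolation (zdGraph 2) half).real
          {ω | IsPivotal (Aloc m F η) e ω} +
        1 / (4 * (v₀ / 2) * Real.exp (-(2 * N' / (v₀ / 2))) - π * N') * ∑ e ∈ near,
          (bondPercolation (zdGraph 2) half).real {ω | IsPivotal (Aloc m F η) e ω} := by
  set μ := bondPercolation (zdGraph 2) half with hμ
  have hmass := percut_mass m F hη hW hnear hπ (half_pos hv₀) hN' hπN hsmall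
  have hsum1 : ∑ ξ ∈ L.powerset, μ.real {ω | obs ω L = ξ} = 1 :=
    sum_powerset_measureReal_obs_eq (zdGraph 2) half L
  have hpt : ∀ ξ ∈ L.powerset, μ.real {ω | obs ω L = ξ} *
      (μ.real {ω' : BondConfig (Site 2) | ω' \ ↑L ∪ ↑ξ ∈ Aloc m F η} *
        (1 - μ.real {ω' : BondConfig (Site 2) | ω' \ ↑L ∪ ↑ξ ∈ Aloc m F η})) ≤
      (if v₀ / 2 ≤ μ.real {ω' : BondConfig (Site 2) | ω' \ ↑L ∪ ↑ξ ∈ Aloc m F η} *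
          (1 - μ.real {ω' : BondConfig (Site 2) | ω' \ ↑L ∪ ↑ξ ∈ Aloc m F η})
        then μ.real {ω | obs ω L = ξ} else 0) * (1 / 4) +
      μ.real {ω | obs ω L = ξ} * (v₀ / 2) := by
    intro ξ _
    have hw : 0 ≤ μ.real {ω | obs ω L = ξ} := measureReal_nonneg
    set t := μ.real {ω' : BondConfig (Site 2) | ω' \ ↑L ∪ ↑ξ ∈ Aloc m F η} with ht
    have ht4 : t * (1 - t) ≤ 1 / 4 := by nlinarith [sq_nonneg (t - 1 / 2)]
    split_ifs with hg
    · nlinarith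
    · rw [not_le] at hg
      rw [zero_mul, zero_add]
      exact mul_le_mul_of_nonneg_left hg.le hw
  have hkey : v₀ ≤ (∑ ξ ∈ L.powerset.filter (fun ξ : Finset (Sym2 (Site 2)) => v₀ / 2 ≤
      μ.real {ω' : BondConfig (Site 2) | ω' \ ↑L ∪ ↑ξ ∈ Aloc m F η} *
        (1 - μ.real {ω' : BondConfig (Site 2) | ω' \ ↑L ∪ ↑ξ ∈ Aloc m F η})),
        μ.real {ω | obs ω L = ξ}) * (1 / 4) + v₀ / 2 := by
    calc v₀ ≤ _ := hmean
      _ ≤ _ := Finset.sum_le_sum hpt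
      _ = _ := by
          rw [Finset.sum_add_distrib, ← Finset.sum_mul, ← Finset.sum_mul, hsum1,
            ← Finset.sum_filter]
          ring
  linarith

end Summit.CriticalPhenomena.CardyFormulaZ2.Theorems.CardySelfRefinement

end
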